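import Summits.QuantumFields.YangMills.Theorems.UnitScaleTiltProp7CmapTwSJointRowPertVarT3
import Summits.QuantumFields.YangMills.Theorems.UnitScaleTiltProp7PertVarCurrencyExchange
import HarnessLib

/-!
# Route `UnitScaleTilt`, crux K1 «MinimiserStabilityRegPr» (stmt-QuantumFields-19200), route-R E′ (A′)-on-Σ (★★OWNER RULING g28-№13 ∕ g29-№16), package P-A2 «JOINT-Σ» —
# **F4″-S IN THE JOINT DOOR'S `X`-CURRENCY: `Σ_ĉ ‖C^{twS}_W(iD)(ĉ)‖ ≤ C₁ˢ·ℓ⁻¹·Σ_b‖D b‖² + C₂ˢ·ℓ·(K_W(iD) + dv)`**, `ℓ = L^{K−n}`, `dv := DIV_HS_W(iD)`, with `K_W` the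
# plaquette form of ✓`Prop7HcoSEndToEnd`'s `hPA2` ∕ ✓`Prop7HcoSOfSigmaRows` :118–125 TOKEN FOR TOKEN (routeR-w2 g8 04:53:54Z) and `dv` the LEFT letter of px12 g6's ✓DV-SEAM
# `sum_normSq_divB_smul_I_le_of_memberDivSq` — the S-half of the COMB target `hPA2` (the other half: px18 g3's ✓`Prop7CombSymBCHDoor` + (R1)(R2)).

Cell `ym3-torus`, D-0154 (3c) twin-width seat `ym-routeR-w3` (gen 7); `--supports stmt-QuantumFields-19200 --as helper`, count-neutral, def-free.  YM₃ on T³ is a ladder rung (R3),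
NOT the Clay problem; nothing here is a claim about the stub, the crux, d = 4 or the mass gap.

THE ARGUMENT (all by name).  ✓`Prop7CmapTwSJointRowPertVar.sum_norm_CmapTwS_le_jointRow_pertVar` (F4″-S in (n3) currency) ∘ routeR-w4 g15's ✓`Prop7PertVarCurrencyExchange`
(`sum_normSq_pertVar_le`: `M₀ ≤ Σ‖D‖²`; `curlHS_pertVar_le_plaqK` at `a := ε₀·(ℓ²)⁻¹` (✓`Prop7TwistedLevelMassOfRegPr.plaq_le_of_regPr`): `CURL ≤ 8·K_W(iD) + 6(64a² + 8s²)·Σ‖D‖²`;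
`divHS_pertVar_le`: `DIV ≤ 2·dv + 12s²·Σ‖D‖²`) with the Σ-class sup `‖D b‖ ≤ σ·ℓ⁻¹` (so every spill is `O(1)·ℓ⁻¹·Σ‖D‖²`), and the elementary `L²∕(L−q) ≤ 2L`, `L²∕(L³−q) ≤ 2∕L`
(`q = 1 + 2·10¹⁵L⁵ε₀ ≤ 5∕4`, `L ≥ 3`); the real bookkeeping is isolated in `knit_arith`.

WHAT THIS FILE PROVES (sorry-free).
* `ratio_bounds` (`L²∕(L−q) ≤ 2L`, `L²∕(L³−q) ≤ 2∕L`), `knit_arith` (letter-free real bookkeeping).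
* ★★★ **`sum_norm_CmapTwS_le_jointRow_X`** — for `RegPr F n K ε₀ W`, `D` bondwise Hermitian traceless with `‖D b‖ ≤ σ·(L^{K−n})⁻¹` and `‖iD‖ < e·η`, windows `10⁹L²e ≤ 1`,
  `10¹⁴L⁹ε₀ ≤ 1`, `0 ≤ σ`, `4·10¹¹L⁹σ ≤ 1`:
  `Σ_{ĉ : PBond (F.P n) 0} ‖CmapTwS F n K h W (fun b ↦ I•D b) ĉ‖ ≤ C₁ˢ * ((F.L:ℝ)^(K−n))⁻¹ * (Σ_b ‖D b‖²) + C₂ˢ * (F.L:ℝ)^(K−n) * (K_W(iD) + dv)`,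
  `C₁ˢ = 10⁹L⁴·(2L·cA + (2∕L)·(cB₁·(384 + 60σ²) + cB₂))`, `C₂ˢ = 10⁹L⁴·(2∕L)·8·cB₁`, `cA = 4(21+10080L³)`, `cB₁ = 4(3+720L²)·28800L⁴`, `cB₂ = 4(3+720L²)·600000L⁴` — L∕σ-only.
HONEST SCOPE.  Instantiation + real arithmetic; constants crude; nothing of `hPA2`'s COMB row, hcoS, E′, EX or the crux is claimed.

References: T. Bałaban, CMP **102** (1985) 277–309 [Balaban1985Variational] ((15) p.280, (19)–(20) p.281, (44)–(48) pp.285–286, Prop. 7 p.299); CMP **99** (1985) 389–434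
[Balaban1985BackgroundPropagators] ((3.3)–(3.8) pp.391–392); CMP **98** (1985) 17–51 [Balaban1985Averaging] ((150)–(152) p.40).
-/

set_option autoImplicit false

noncomputable section

open scoped BigOperators Matrix.Norms.L2Operator Matrix

namespace Summit.QuantumFields.YangMills.Theorems.Prop7CmapTwSJointRowX

open NormedSpace Finset
open Literature.MathematicalPhysics.QuantumFieldTheory.Balaban1983to89
open Literature.MathematicalPhysics.QuantumFieldTheory.Balaban1983to89.T3ContinuumYM3Torus
open T4Continuum BlockAveraging AveragingRT ExpMeanLog BlockAveragingEMLLinearised BlockAveragingEMLLinearisedBackground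
open MatrixLog (mlog)
open B9Eq39Adjoint (curl divB)
open B9TorusCalculus (torusT)
open B7Prop1Explicit (expUnit val_expUnit)
open B10Eq27TorusAxialLog (unitsField toUField)
open T3PrintedRegularMinimiser (RegPr)
open T3SectALandauChart (eta eta_pos bgUnits emb15 pos_of_regPr)
open Summit.QuantumFields.YangMills.Theorems.Prop7TPrint (expHermField)
open Summit.QuantumFields.YangMills.Theorems.Prop7SymAvgTwSym (CmapTwS)
open Summit.QuantumFields.YangMills.Theorems.Prop7TwistedLevelMassOfRegPr (plaq_le_of_regPr)
open Summit.QuantumFields.YangMills.Theorems.Prop7Chart48SymUntwisted (unitsField_toUField_emb15_expHermField)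
open Summit.QuantumFields.YangMills.Theorems.Prop7CmapTwSJointRowPertVar (sum_norm_CmapTwS_le_jointRow_pertVar q_lt_L)
open Summit.QuantumFields.YangMills.Theorems.Prop7PertVarCurrencyExchange (sum_normSq_pertVar_le curlHS_pertVar_le_plaqK divHS_pertVar_le)

variable (F : T3Family) (n K : ℕ) (h : n ≤ K)
variable {n K}

/-! ## §1 Real bookkeeping -/

/-- `L²∕(L−q) ≤ 2L` and `L²∕(L³−q) ≤ 2∕L` for `q ≤ 5∕4`, `3 ≤ L`. [folklore] -/
theorem ratio_bounds {L q : ℝ} (hL : 3 ≤ L) (hq : q ≤ 5 / 4) :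
    0 ≤ L ^ 2 / (L - q) ∧ L ^ 2 / (L - q) ≤ 2 * L ∧ 0 ≤ L ^ 2 / (L ^ 3 - q) ∧ L ^ 2 / (L ^ 3 - q) ≤ 2 / L := by
  have hL0 : 0 < L := by linarith
  have h1 : 0 < L - q := by linarith
  have hL3 : 27 ≤ L ^ 3 := by nlinarith [sq_nonneg L, sq_nonneg (L - 3)]
  have h2 : 0 < L ^ 3 - q := by linarith
  refine ⟨by positivity, ?_, by positivity, ?_⟩
  · rw [div_le_iff₀ h1]; nlinarith
  · rw [div_le_div_iff₀ h2 hL0]; nlinarith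

set_option maxHeartbeats 400000 in
/-- **THE LETTER-FREE BOOKKEEPING OF THE KNIT** (`u = ℓ⁻¹`, `0 < ℓ`, `1 ≤ ℓ`; `T ≥ 0`): the (n3)-currency bound `S ≤ T·(cA·M₀·r₁·u + (cB₁(CU + DV) + cB₂·1·(ℓ²)⁻¹·M₀)·r₂·ℓ)` together with
`M₀ ≤ M`, `CU ≤ 4N·Kp + N·d·(64a² + 8s²)·M`, `DV ≤ 2·DX + 2N·d·s²·M` (`N = 2`, `d = 3`, `a = ε₀u²`, `s = σu`, `ε₀ ≤ 1`), `r₁ ≤ 2L`, `r₂ ≤ 2∕L` gives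
`S ≤ T(2L·cA + (2∕L)(cB₁(384 + 60σ²) + cB₂))·u·M + T(2∕L)·8cB₁·ℓ·(Kp + DX)`. [folklore] -/
theorem knit_arith {L ℓ u ε₀ σ M M₀ Kp CU DV DX S cA cB₁ cB₂ r₁ r₂ T N d a s : ℝ} (hL : 3 ≤ L) (hℓ0 : 0 < ℓ) (hℓ1 : 1 ≤ ℓ) (hu : u = ℓ⁻¹) (hT : 0 ≤ T)
    (hε₀0 : 0 ≤ ε₀) (hε₀1 : ε₀ ≤ 1) (hM0 : 0 ≤ M) (hM₀0 : 0 ≤ M₀) (hM₀ : M₀ ≤ M) (hKp : 0 ≤ Kp) (hDX : 0 ≤ DX)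
    (hcA : 0 ≤ cA) (hcB₁ : 0 ≤ cB₁) (hcB₂ : 0 ≤ cB₂) (hr₁0 : 0 ≤ r₁) (hr₁ : r₁ ≤ 2 * L) (hr₂0 : 0 ≤ r₂) (hr₂ : r₂ ≤ 2 / L)
    (hN : N = 2) (hd : d = 3) (ha : a = ε₀ * u ^ 2) (hsu : s = σ * u)
    (hCU0 : 0 ≤ CU) (hCU : CU ≤ 4 * N * Kp + N * d * (64 * a ^ 2 + 8 * s ^ 2) * M) (hDV0 : 0 ≤ DV) (hDV : DV ≤ 2 * DX + 2 * N * d * s ^ 2 * M)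
    (hS : S ≤ T * (cA * M₀ * r₁ * ℓ⁻¹ + (cB₁ * (CU + DV) + cB₂ * 1 * (ℓ ^ 2)⁻¹ * M₀) * r₂ * ℓ)) :
    S ≤ T * (2 * L * cA + 2 / L * (cB₁ * (384 + 60 * σ ^ 2) + cB₂)) * ℓ⁻¹ * M + T * (2 / L * (8 * cB₁)) * ℓ * (Kp + DX) := by
  subst hN hd ha hsu hu
  have hL0 : 0 < L := by linarith
  have h2L : 0 ≤ 2 / L := by positivity
  have hu0 : 0 < ℓ⁻¹ := by positivity
  have hu1 : ℓ⁻¹ ≤ 1 := inv_le_one_of_one_le₀ hℓ1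
  have hℓu : ℓ * ℓ⁻¹ = 1 := mul_inv_cancel₀ hℓ0.ne'
  have hℓ2 : (ℓ ^ 2)⁻¹ = ℓ⁻¹ ^ 2 := by rw [inv_pow]
  rw [hℓ2] at hS
  -- simplified inputs
  have hCU' : CU ≤ 8 * Kp + 6 * (64 * (ε₀ * ℓ⁻¹ ^ 2) ^ 2 + 8 * (σ * ℓ⁻¹) ^ 2) * M := by
    have e : 4 * (2:ℝ) * Kp + 2 * 3 * (64 * (ε₀ * ℓ⁻¹ ^ 2) ^ 2 + 8 * (σ * ℓ⁻¹) ^ 2) * M = 8 * Kp + 6 * (64 * (ε₀ * ℓ⁻¹ ^ 2) ^ 2 + 8 * (σ * ℓ⁻¹) ^ 2) * M := by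
      ring
    rw [← e]; exact hCU
  have hDV' : DV ≤ 2 * DX + 12 * (σ * ℓ⁻¹) ^ 2 * M := by
    have e : 2 * DX + 2 * (2:ℝ) * 3 * (σ * ℓ⁻¹) ^ 2 * M = 2 * DX + 12 * (σ * ℓ⁻¹) ^ 2 * M := by ring
    rw [← e]; exact hDV
  -- (i) the decaying channel
  have hX1 : cA * M₀ * r₁ * ℓ⁻¹ ≤ cA * M * (2 * L) * ℓ⁻¹ :=
    mul_le_mul_of_nonneg_right (mul_le_mul (mul_le_mul_of_nonneg_left hM₀ hcA) hr₁ hr₁0 (by positivity)) hu0.le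
  -- (ii) the growing channel
  have hX2 : (cB₁ * (CU + DV) + cB₂ * 1 * ℓ⁻¹ ^ 2 * M₀) * r₂ * ℓ ≤
      (cB₁ * ((8 * Kp + 6 * (64 * (ε₀ * ℓ⁻¹ ^ 2) ^ 2 + 8 * (σ * ℓ⁻¹) ^ 2) * M) + (2 * DX + 12 * (σ * ℓ⁻¹) ^ 2 * M)) + cB₂ * 1 * ℓ⁻¹ ^ 2 * M) * (2 / L) * ℓ := by
    have hsum' : CU + DV ≤ (8 * Kp + 6 * (64 * (ε₀ * ℓ⁻¹ ^ 2) ^ 2 + 8 * (σ * ℓ⁻¹) ^ 2) * M) + (2 * DX + 12 * (σ * ℓ⁻¹) ^ 2 * M) := add_le_add hCU' hDV'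
    have hin : cB₁ * (CU + DV) + cB₂ * 1 * ℓ⁻¹ ^ 2 * M₀ ≤
        cB₁ * ((8 * Kp + 6 * (64 * (ε₀ * ℓ⁻¹ ^ 2) ^ 2 + 8 * (σ * ℓ⁻¹) ^ 2) * M) + (2 * DX + 12 * (σ * ℓ⁻¹) ^ 2 * M)) + cB₂ * 1 * ℓ⁻¹ ^ 2 * M :=
      add_le_add (mul_le_mul_of_nonneg_left hsum' hcB₁) (mul_le_mul_of_nonneg_left hM₀ (by positivity))
    have hin0 : 0 ≤ cB₁ * (CU + DV) + cB₂ * 1 * ℓ⁻¹ ^ 2 * M₀ := by positivity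
    exact mul_le_mul (mul_le_mul hin hr₂ hr₂0 (hin0.trans hin)) le_rfl hℓ0.le (by positivity)
  -- (iii) expand the growing channel with `ℓ·ℓ⁻¹ = 1`, `ℓ⁻¹ ≤ 1`, `ε₀ ≤ 1`
  have hu2 : ℓ * ℓ⁻¹ ^ 2 = ℓ⁻¹ := by rw [sq, ← mul_assoc, hℓu, one_mul]
  have hu4 : ℓ * ℓ⁻¹ ^ 4 ≤ ℓ⁻¹ := by
    have e : ℓ * ℓ⁻¹ ^ 4 = ℓ⁻¹ * ℓ⁻¹ ^ 2 := by rw [show ℓ⁻¹ ^ 4 = ℓ⁻¹ ^ 2 * ℓ⁻¹ ^ 2 by ring, ← mul_assoc, hu2]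
    rw [e]
    have : ℓ⁻¹ ^ 2 ≤ 1 := by nlinarith
    nlinarith
  have hε2 : ε₀ ^ 2 ≤ 1 := by nlinarith
  have tK : cB₁ * (8 * Kp) * (2 / L) * ℓ + cB₁ * (2 * DX) * (2 / L) * ℓ ≤ 2 / L * (8 * cB₁) * ℓ * (Kp + DX) := by
    have e : 2 / L * (8 * cB₁) * ℓ * (Kp + DX) - (cB₁ * (8 * Kp) * (2 / L) * ℓ + cB₁ * (2 * DX) * (2 / L) * ℓ) = 2 / L * ℓ * cB₁ * 6 * DX := by ring
    have h0 : 0 ≤ 2 / L * ℓ * cB₁ * 6 * DX := by positivity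
    linarith
  have ta : cB₁ * (6 * (64 * (ε₀ * ℓ⁻¹ ^ 2) ^ 2) * M) * (2 / L) * ℓ ≤ 2 / L * (cB₁ * 384) * ℓ⁻¹ * M := by
    have e : cB₁ * (6 * (64 * (ε₀ * ℓ⁻¹ ^ 2) ^ 2) * M) * (2 / L) * ℓ = 2 / L * (cB₁ * 384) * (ε₀ ^ 2 * (ℓ * ℓ⁻¹ ^ 4)) * M := by ring
    rw [e]
    have h1 : ε₀ ^ 2 * (ℓ * ℓ⁻¹ ^ 4) ≤ ℓ⁻¹ := by
      have := mul_le_mul hε2 hu4 (by positivity) zero_le_one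
      linarith
    have h0 : 0 ≤ 2 / L * (cB₁ * 384) := by positivity
    exact mul_le_mul_of_nonneg_right (mul_le_mul_of_nonneg_left h1 h0) hM0
  have ts : cB₁ * (6 * (8 * (σ * ℓ⁻¹) ^ 2) * M + 12 * (σ * ℓ⁻¹) ^ 2 * M) * (2 / L) * ℓ = 2 / L * (cB₁ * (60 * σ ^ 2)) * ℓ⁻¹ * M := by
    have e : cB₁ * (6 * (8 * (σ * ℓ⁻¹) ^ 2) * M + 12 * (σ * ℓ⁻¹) ^ 2 * M) * (2 / L) * ℓ = 2 / L * (cB₁ * (60 * σ ^ 2)) * (ℓ * ℓ⁻¹ ^ 2) * M := by ring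
    rw [e, hu2]
  have tB : cB₂ * 1 * ℓ⁻¹ ^ 2 * M * (2 / L) * ℓ = 2 / L * cB₂ * ℓ⁻¹ * M := by
    have e : cB₂ * 1 * ℓ⁻¹ ^ 2 * M * (2 / L) * ℓ = 2 / L * cB₂ * (ℓ * ℓ⁻¹ ^ 2) * M := by ring
    rw [e, hu2]
  have hexp : (cB₁ * ((8 * Kp + 6 * (64 * (ε₀ * ℓ⁻¹ ^ 2) ^ 2 + 8 * (σ * ℓ⁻¹) ^ 2) * M) + (2 * DX + 12 * (σ * ℓ⁻¹) ^ 2 * M)) + cB₂ * 1 * ℓ⁻¹ ^ 2 * M) * (2 / L) * ℓ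
      = (cB₁ * (8 * Kp) * (2 / L) * ℓ + cB₁ * (2 * DX) * (2 / L) * ℓ) + cB₁ * (6 * (64 * (ε₀ * ℓ⁻¹ ^ 2) ^ 2) * M) * (2 / L) * ℓ
        + cB₁ * (6 * (8 * (σ * ℓ⁻¹) ^ 2) * M + 12 * (σ * ℓ⁻¹) ^ 2 * M) * (2 / L) * ℓ + cB₂ * 1 * ℓ⁻¹ ^ 2 * M * (2 / L) * ℓ := by ring
  have hgrow : (cB₁ * ((8 * Kp + 6 * (64 * (ε₀ * ℓ⁻¹ ^ 2) ^ 2 + 8 * (σ * ℓ⁻¹) ^ 2) * M) + (2 * DX + 12 * (σ * ℓ⁻¹) ^ 2 * M)) + cB₂ * 1 * ℓ⁻¹ ^ 2 * M) * (2 / L) * ℓ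
      ≤ 2 / L * (cB₁ * (384 + 60 * σ ^ 2) + cB₂) * ℓ⁻¹ * M + 2 / L * (8 * cB₁) * ℓ * (Kp + DX) := by
    rw [hexp, ts, tB]
    have e : 2 / L * (cB₁ * (384 + 60 * σ ^ 2) + cB₂) * ℓ⁻¹ * M = 2 / L * (cB₁ * 384) * ℓ⁻¹ * M + 2 / L * (cB₁ * (60 * σ ^ 2)) * ℓ⁻¹ * M + 2 / L * cB₂ * ℓ⁻¹ * M := by
      ring
    rw [e]
    linarith [tK, ta]
  have hsum : cA * M₀ * r₁ * ℓ⁻¹ + (cB₁ * (CU + DV) + cB₂ * 1 * ℓ⁻¹ ^ 2 * M₀) * r₂ * ℓ ≤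
      (2 * L * cA + 2 / L * (cB₁ * (384 + 60 * σ ^ 2) + cB₂)) * ℓ⁻¹ * M + 2 / L * (8 * cB₁) * ℓ * (Kp + DX) := by
    have e : (2 * L * cA + 2 / L * (cB₁ * (384 + 60 * σ ^ 2) + cB₂)) * ℓ⁻¹ * M =
        cA * M * (2 * L) * ℓ⁻¹ + 2 / L * (cB₁ * (384 + 60 * σ ^ 2) + cB₂) * ℓ⁻¹ * M := by ring
    rw [e]
    linarith [hX1, hX2, hgrow]
  calc S ≤ T * (cA * M₀ * r₁ * ℓ⁻¹ + (cB₁ * (CU + DV) + cB₂ * 1 * ℓ⁻¹ ^ 2 * M₀) * r₂ * ℓ) := hS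
    _ ≤ T * ((2 * L * cA + 2 / L * (cB₁ * (384 + 60 * σ ^ 2) + cB₂)) * ℓ⁻¹ * M + 2 / L * (8 * cB₁) * ℓ * (Kp + DX)) :=
        mul_le_mul_of_nonneg_left hsum hT
    _ = _ := by ring

/-! ## §2 ★★★ F4″-S in the JOINT door's `X`-currency -/

set_option maxHeartbeats 400000 in
/-- ★★★ **F4″-S IN `X`-CURRENCY (the S-half of `hPA2`)**: for `RegPr F n K ε₀ W`, `D` bondwise Hermitian traceless with `‖D b‖ ≤ σ·(L^{K−n})⁻¹`, `‖iD‖ < e·η`, windows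
`10⁹L²e ≤ 1`, `10¹⁴L⁹ε₀ ≤ 1`, `0 ≤ σ`, `4·10¹¹L⁹σ ≤ 1`:
`Σ_ĉ ‖C^{twS}_W(iD)(ĉ)‖ ≤ C₁ˢ·(L^{K−n})⁻¹·Σ_b‖D b‖² + C₂ˢ·L^{K−n}·(K_W(iD) + DIV_HS_W(iD))` with `K_W` the JOINT door's plaquette form and `DIV_HS_W(iD)` px12's DV-SEAM letter.
[cite: Balaban1985Variational, (15) p.280, (19)-(20) p.281, (44)-(48) pp.285-286, Prop. 7 p.299; Balaban1985BackgroundPropagators, (3.3)-(3.8) pp.391-392] -/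
theorem sum_norm_CmapTwS_le_jointRow_X {ε₀ e σ : ℝ} (he : 0 < e) (hWe : 10 ^ 9 * (F.L : ℝ) ^ 2 * e ≤ 1)
    (hWε : 100000000000000 * (F.L : ℝ) ^ 9 * ε₀ ≤ 1) (hσ0 : 0 ≤ σ) (hσL : 400000000000 * (F.L : ℝ) ^ 9 * σ ≤ 1)
    (W : GaugeField (F.P K) 0 (Matrix.specialUnitaryGroup (Fin 2) ℂ)) (hreg : RegPr F n K ε₀ W)
    (D : PBond (F.P K) 0 → Matrix (Fin 2) (Fin 2) ℂ) (hD : ∀ b : PBond (F.P K) 0, (D b).IsHermitian ∧ Matrix.trace (D b) = 0)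
    (hs : ∀ b : PBond (F.P K) 0, ‖D b‖ ≤ σ * ((F.L : ℝ) ^ (K - n))⁻¹) (hXr : ‖(fun b : PBond (F.P K) 0 => Complex.I • D b)‖ < e * eta F n K) :
    ∑ c : PBond (F.P n) 0, ‖CmapTwS F n K h W (fun b : PBond (F.P K) 0 => Complex.I • D b) c‖ ≤
      (10 ^ 9 * (F.L : ℝ) ^ 4 * (2 * (F.L : ℝ) * (4 * (21 + 10080 * (F.L : ℝ) ^ 3)) +
          2 / (F.L : ℝ) * ((4 * (3 + 720 * (F.L : ℝ) ^ 2) * (28800 * (F.L : ℝ) ^ 4)) * (384 + 60 * σ ^ 2) + 4 * (3 + 720 * (F.L : ℝ) ^ 2) * (600000 * (F.L : ℝ) ^ 4)))) *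
        ((F.L : ℝ) ^ (K - n))⁻¹ * (∑ b : PBond (F.P K) 0, ‖D b‖ ^ 2) +
      (10 ^ 9 * (F.L : ℝ) ^ 4 * (2 / (F.L : ℝ) * (8 * (4 * (3 + 720 * (F.L : ℝ) ^ 2) * (28800 * (F.L : ℝ) ^ 4))))) * (F.L : ℝ) ^ (K - n) *
        ((∑ p : Plaq (F.P K) 0, ‖((Complex.I • D ⟨p.src, p.μ⟩)
            + ((W ⟨p.src, p.μ⟩ : Matrix (Fin 2) (Fin 2) ℂ) * (Complex.I • D ⟨p.src.shift p.μ, p.ν⟩) * star (W ⟨p.src, p.μ⟩ : Matrix (Fin 2) (Fin 2) ℂ))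
            - (((W ⟨p.src, p.μ⟩ * W ⟨p.src.shift p.μ, p.ν⟩ * (W ⟨p.src.shift p.ν, p.μ⟩)⁻¹ : Matrix.specialUnitaryGroup (Fin 2) ℂ) : Matrix (Fin 2) (Fin 2) ℂ)
                * (Complex.I • D ⟨p.src.shift p.ν, p.μ⟩)
                * star ((W ⟨p.src, p.μ⟩ * W ⟨p.src.shift p.μ, p.ν⟩ * (W ⟨p.src.shift p.ν, p.μ⟩)⁻¹ : Matrix.specialUnitaryGroup (Fin 2) ℂ) : Matrix (Fin 2) (Fin 2) ℂ))
            - (((GaugeField.plaqHol W p : Matrix.specialUnitaryGroup (Fin 2) ℂ) : Matrix (Fin 2) (Fin 2) ℂ) * (Complex.I • D ⟨p.src, p.ν⟩)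
                * star ((GaugeField.plaqHol W p : Matrix.specialUnitaryGroup (Fin 2) ℂ) : Matrix (Fin 2) (Fin 2) ℂ)))‖ ^ 2) +
          (∑ x : Site (F.P K) 0, ∑ j : Fin 2, ∑ k : Fin 2,
            ‖(divB (torusT (F.P K) 0) (fun κ z => unitsField (toUField W) ⟨z, κ⟩) (fun κ z => Complex.I • D ⟨z, κ⟩) x) j k‖ ^ 2)) := by
  have hε₀ : 0 < ε₀ := pos_of_regPr F hreg
  have hL3 : (3 : ℝ) ≤ (F.L : ℝ) := Prop7CurvedLandauKnitT3.three_le_L F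
  have hL1 : (1 : ℝ) ≤ (F.L : ℝ) := by linarith
  have hL0 : (0 : ℝ) < (F.L : ℝ) := by linarith
  have hℓ1 : (1 : ℝ) ≤ (F.L : ℝ) ^ (K - n) := one_le_pow₀ hL1
  have hℓ0 : (0 : ℝ) < (F.L : ℝ) ^ (K - n) := by positivity
  -- the (n3)-currency sup data: `s := σ·ℓ⁻¹`
  have hs0 : 0 ≤ σ * ((F.L : ℝ) ^ (K - n))⁻¹ := by positivity
  have hs4 : 4 * (σ * ((F.L : ℝ) ^ (K - n))⁻¹) ≤ 1 := by
    have hu1 : ((F.L : ℝ) ^ (K - n))⁻¹ ≤ 1 := inv_le_one_of_one_le₀ hℓ1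
    have h1 : σ * ((F.L : ℝ) ^ (K - n))⁻¹ ≤ σ := by nlinarith
    have h9 : (1 : ℝ) ≤ (F.L : ℝ) ^ 9 := one_le_pow₀ hL1
    nlinarith
  have hsL : 400000000000 * (F.L : ℝ) ^ 9 * (((F.L : ℝ) ^ (K - n)) * (σ * ((F.L : ℝ) ^ (K - n))⁻¹)) ≤ 1 := by
    rw [show (F.L : ℝ) ^ (K - n) * (σ * ((F.L : ℝ) ^ (K - n))⁻¹) = σ by field_simp]
    exact hσL
  have hG1 := sum_norm_CmapTwS_le_jointRow_pertVar F h he hWe hWε hs0 hs4 hsL W hreg D hD hs hXr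
  -- the currency exchange
  have hcomp := unitsField_toUField_emb15_expHermField F W D hD
  have hU : ∀ b : PBond (F.P K) 0, ((emb15 W (expHermField D) b : Matrix.specialUnitaryGroup (Fin 2) ℂ) : Matrix (Fin 2) (Fin 2) ℂ) =
      exp (Complex.I • D b) * ((W b : Matrix.specialUnitaryGroup (Fin 2) ℂ) : Matrix (Fin 2) (Fin 2) ℂ) := by
    intro b
    have h1 := congrArg (fun u : (Matrix (Fin 2) (Fin 2) ℂ)ˣ => (u : Matrix (Fin 2) (Fin 2) ℂ)) (congrFun hcomp b)
    simp only [Units.val_mul, val_expUnit] at h1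
    exact h1
  have hX : ∀ b : PBond (F.P K) 0, (D b).IsHermitian := fun b => (hD b).1
  have hM₀ := sum_normSq_pertVar_le W (emb15 W (expHermField D)) D hX hU
  have ha := plaq_le_of_regPr F n K hreg
  have hCU := curlHS_pertVar_le_plaqK W (emb15 W (expHermField D)) D hX hU hs ha
  have hDV := divHS_pertVar_le W (emb15 W (expHermField D)) D hX hU hs
  -- bookkeeping letters
  have hq54 : 1 + 2 * 10 ^ 15 * (F.L : ℝ) ^ 5 * ε₀ ≤ 5 / 4 := by
    have h4 : (81 : ℝ) ≤ (F.L : ℝ) ^ 4 := by nlinarith [sq_nonneg ((F.L : ℝ) ^ 2 - 9), sq_nonneg (F.L : ℝ)]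
    have hkey : 2 * 10 ^ 15 * (F.L : ℝ) ^ 5 * ε₀ * (F.L : ℝ) ^ 4 ≤ 20 := by
      have e : 2 * 10 ^ 15 * (F.L : ℝ) ^ 5 * ε₀ * (F.L : ℝ) ^ 4 = 20 * (100000000000000 * (F.L : ℝ) ^ 9 * ε₀) := by ring
      rw [e]; linarith
    have hnn : (0 : ℝ) ≤ 2 * 10 ^ 15 * (F.L : ℝ) ^ 5 * ε₀ := by positivity
    nlinarith [mul_le_mul_of_nonneg_left h4 hnn]
  obtain ⟨hr₁0, hr₁, hr₂0, hr₂⟩ := ratio_bounds (q := 1 + 2 * 10 ^ 15 * (F.L : ℝ) ^ 5 * ε₀) hL3 hq54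
  have hε₀1 : ε₀ ≤ 1 := by
    have h9 : (1 : ℝ) ≤ (F.L : ℝ) ^ 9 := one_le_pow₀ hL1
    nlinarith
  have hd : ((F.P K).d : ℝ) = 3 := by rw [T3Family.P_d F K]; norm_num
  have hCU0 : 0 ≤ ∑ x : Site (F.P K) 0, ∑ μ : Fin (F.P K).d, ∑ ν : Fin (F.P K).d,
      (if μ < ν then ∑ j : Fin 2, ∑ k : Fin 2,
        ‖(curl (torusT (F.P K) 0) (fun κ z => unitsField (toUField W) ⟨z, κ⟩) (fun κ z => pertVar W (emb15 W (expHermField D)) ⟨z, κ⟩) μ ν x) j k‖ ^ 2 else 0) := by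
    refine sum_nonneg fun x _ => sum_nonneg fun μ _ => sum_nonneg fun ν _ => ?_
    split_ifs
    · positivity
    · exact le_rfl
  exact knit_arith (T := 10 ^ 9 * (F.L : ℝ) ^ 4) hL3 hℓ0 hℓ1 rfl (by positivity) hε₀.le hε₀1 (by positivity) (by positivity) hM₀
    (by positivity) (by positivity) (by positivity) (by positivity) (by positivity) hr₁0 hr₁ hr₂0 hr₂
    (by norm_num : ((2 : ℕ) : ℝ) = 2) hd (by rw [inv_pow]) rfl hCU0 hCU (by positivity) hDV hG1

end Summit.QuantumFields.YangMills.Theorems.Prop7CmapTwSJointRowX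

end
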